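import Summits.CriticalPhenomena.PercolationContinuityZ3.Theorems.PercBurnResprinkleUniformDiminishmentCases

/-!
# Uniform diminishment on `ℤ³` (6/8): the protruding case and the local modification lemma

Helper file for item `stmt-CriticalPhenomena-7206` (`PercBurnResprinkle.UniformDiminishment`, the quenched,
uniform Aizenman–Grimmett diminishment on `ℤ³`), landed with `--supports stmt-CriticalPhenomena-7206`.
The proof runs the in-tree Aizenman–Grimmett engine (`Literature.Probability.Percolation.AGLine`, after
Martineau–Severo 2019 §6) for the two-parameter model "edges open with probability `p`, points of the
thinned deleted set restored with probability `s`"; no definitions are introduced — the available-edge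
map `av` and the exit event `A` enter through characterising hypotheses (`hav`, `hA`).

Contents: the local modification in the case `Q ⊄ o + box r` (`exists_pivotal_of_not_subset`: the
target is the centre of the protruding face, which is far), and the set-level local modification lemma
`exists_local_modification` (Aizenman–Grimmett 1991 Lemma 2 / Martineau–Severo 2019 Lemma 6.1 for the
restoration enhancement, with all radii depending on `R` only): stop a far-reaching available path at
its first far vertex, make it simple, observe it uses the pivotal edge, and operate around the tile
point of a non-far endpoint.
-/

namespace Summit.CriticalPhenomena.PercolationContinuityZ3.Theorems

open Literature.Probability.Percolation Literature.Probability.LatticeModels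

namespace UnifDim

/-! ### The local modification: the two cases -/

section Cases

variable {D : Set (Site 3)} {av : Set (Sym2 (Site 3) ⊕ Site 3) → Set (Sym2 (Site 3))}
  {A : Set (Set (Sym2 (Site 3) ⊕ Site 3))} {o : Site 3} {r : ℕ}


/-- The target in the protruding case: the centre `t` of the protruding face is far, in the box,
`≠ d`, on the target side of the axis line, off the entrance face; and the entrance level lies in
`o + box r`. -/
theorem target_of_protrusion {d o : Site 3} {ρ r : ℕ} {i : Fin 3} {s s' : ℤ} (hρ : 1 ≤ ρ) (hρr : ρ ≤ r)
    (hs : (s = d i + ρ ∧ s' = d i - ρ ∧ (r : ℤ) < s - o i) ∨ (s = d i - ρ ∧ s' = d i + ρ ∧ s - o i < -(r : ℤ)))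
    (hdN : d - o ∈ box 3 r) :
    ((s = d i + ρ ∧ s' = d i - ρ) ∨ (s = d i - ρ ∧ s' = d i + ρ)) ∧
    (Function.update d i s - o ∉ box 3 r) ∧ (Function.update d i s - d ∈ box 3 ρ) ∧
    Function.update d i s ≠ d ∧ (-(r : ℤ) ≤ s' - o i ∧ s' - o i ≤ r) ∧
    ((∀ j, j ≠ i → Function.update d i s j = d j) →
      (d i < Function.update d i s i ∧ d i < s) ∨ (Function.update d i s i < d i ∧ s < d i)) ∧
    Function.update d i s i ≠ s' := by
  have hdNi := (sub_mem_box_iff.1 hdN) i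
  have hρr' : (ρ : ℤ) ≤ r := by exact_mod_cast hρr
  have hρ' : (1 : ℤ) ≤ ρ := by exact_mod_cast hρ
  simp only [Function.update_self]
  refine ⟨?_, ?_, update_sub_mem_box (by simp) (by omega), ?_, by omega, fun _ => by omega, by omega⟩
  · rcases hs with ⟨h1, h2, -⟩ | ⟨h1, h2, -⟩
    · exact Or.inl ⟨h1, h2⟩
    · exact Or.inr ⟨h1, h2⟩
  · rw [sub_mem_box_iff]
    intro h
    have := h i
    rw [Function.update_self] at this
    omega
  · intro h
    have := congrFun h i
    rw [Function.update_self] at this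
    omega

/-- **Case `d + box ρ ⊄ o + box r` of the local modification.** -/
theorem exists_pivotal_of_not_subset
    (hav : ∀ ξ f, f ∈ av ξ ↔ Sum.inl f ∈ ξ ∧ f ∈ (zdGraph 3).edgeSet ∧ ∀ y ∈ f, y ∈ D → Sum.inr y ∈ ξ)
    (hA : ∀ ξ, ξ ∈ A ↔ ∃ v, (openGraph (av ξ)).Reachable o v ∧ v - o ∉ box 3 r)
    {ξ : Set (Sym2 (Site 3) ⊕ Site 3)} {e : Sym2 (Site 3)} {x x' v' d : Site 3} {ρ : ℕ}
    (hex : e = s(x, x')) (hm : ξ \ {Sum.inl e} ∉ A) (hxx' : x ≠ x')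
    (γ : (openGraph (av (insert (Sum.inl e) ξ))).Walk o v') (hγ : γ.IsPath)
    (heγ : e ∈ γ.edges) (hnf : ∀ z ∈ γ.support, z ≠ v' → z - o ∈ box 3 r)
    (hρ : 1 ≤ ρ) (hρr : ρ ≤ r) (hdD : d ∈ D) (hdN : d - o ∈ box 3 r) (hxQ : x - d ∈ box 3 ρ)
    (hx'Q : x' - d ∈ box 3 ρ) (hQD : ∀ y, y - d ∈ box 3 ρ → y ∈ D → y = d)
    (hQN : ¬ ∀ v, v - d ∈ box 3 ρ → v - o ∈ box 3 r) :
    ∃ ξ' : Set (Sym2 (Site 3) ⊕ Site 3),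
      (∀ f, (∀ y ∈ f, y - x ∉ box 3 (2 * ρ)) → (Sum.inl f ∈ ξ' ↔ Sum.inl f ∈ ξ)) ∧
      (∀ y, Sum.inr y ∈ ξ' ↔ Sum.inr y ∈ ξ) ∧ IsPivotal A (Sum.inr d) ξ' := by
  classical
  subst hex
  set Q : Set (Site 3) := {v | v - d ∈ box 3 ρ} with hQ
  have hQx : ∀ y ∈ Q, y - x ∈ box 3 (2 * ρ) := fun y hy => sub_mem_box_two_mul hxQ hy
  have hdQ : d ∈ Q := by simp [hQ]
  have hQD' : ∀ y ∈ Q, y ∈ D → y = d := fun y hy => hQD y hy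
  have hoN : o - o ∈ box 3 r := by rw [sub_self]; exact zero_mem_box 3 r
  have hxγ : x ∈ γ.support := γ.fst_mem_support_of_mem_edges heγ
  have hx'γ : x' ∈ γ.support := γ.snd_mem_support_of_mem_edges heγ
  have hGadj : ∀ {u w : Site 3}, (openGraph (av (insert (Sum.inl s(x, x')) ξ))).Adj u w →
      (zdGraph 3).Adj u w := fun h => av_subset_edgeSet hav _ ((openGraph_adj _ _ _).1 h).1
  have havadj : ∀ {u w : Site 3}, (openGraph (av (insert (Sum.inl s(x, x')) ξ))).Adj u w →
      s(u, w) ∈ av (insert (Sum.inl s(x, x')) ξ) := fun h => ((openGraph_adj _ _ _).1 h).1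
  -- the protruding face and the far target
  obtain ⟨i, s, s', hprot⟩ := exists_protrusion hQN
  obtain ⟨hs, htfar, htQ, htd, hP, C1, C4⟩ := target_of_protrusion hρ hρr hprot hdN
  by_cases hoQ : o ∈ Q
  · by_cases hod : o = d
    · -- `o = d`: dummy entrance point on the near face
      set a : Site 3 := Function.update d i s' with ha
      have haQ : a - d ∈ box 3 ρ := update_sub_mem_box (by simp) (by omega)
      have had : a ≠ d := by
        intro h; have := congrFun h i; rw [ha, Function.update_self] at this; omega
      have haN : a - o ∈ box 3 r := update_sub_mem_box hdN hP
      obtain ⟨Xa, Xb, -, -, -, hdXb, hXab, hXaQ, hXbQ, hXaN, hlinka, hlinkb⟩ :=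
        exists_linking_sets (a := a) (t := Function.update d i s) (o := o) (r := r) hs hρ haQ htQ had htd
          haN hdN hP C1
          (fun _ => by rw [ha, Function.update_self]; omega)
          (by rw [ha, Function.update_self]; omega) C4
          (fun _ => by rw [ha, Function.update_self, Function.update_self]; omega)
      refine exists_pivotal_config hav hA hm hxQ hdD hdQ hQD' hQx hXab hdXb hXaQ hXbQ hXaN
        (fun _ => Or.inl hod) (Conn := ∅) (by simp) (by simp) (by simp) (Or.inl hod) hlinka hlinkb
        (Or.inl htfar)
    · -- `o ∈ Q`, `o ≠ d`: entrance point `o`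
      obtain ⟨-, -, -, -, hot, -, -, C2, C3, -, C5⟩ :=
        linking_conditions_of_protrusion (a := o) hρ hρr hprot hoQ hoN hod hdN (Or.inl rfl)
      obtain ⟨Xa, Xb, hoXa, -, -, hdXb, hXab, hXaQ, hXbQ, hXaN, hlinka, hlinkb⟩ :=
        exists_linking_sets (o := o) (r := r) hs hρ hoQ htQ hod htd hoN hdN hP C1 C2 C3 C4 C5
      refine exists_pivotal_config hav hA hm hxQ hdD hdQ hQD' hQx hXab hdXb hXaQ hXbQ hXaN
        (fun _ => Or.inr hoXa) (Conn := ∅) (by simp) (by simp) (by simp) (Or.inr (Or.inl rfl))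
        hlinka hlinkb (Or.inl htfar)
  · -- `o ∉ Q`: first entrance `a₀ → a` of `γ`
    obtain ⟨a₀, a, w₁, ha₀, w₂, hγeq, hw₁, haQ⟩ :=
      exists_first_entrance' Q γ hoQ ⟨x, hxγ, hxQ⟩
    have ha₀Q : a₀ ∉ Q := hw₁ _ w₁.end_mem_support
    have had : a ≠ d := ne_center_of_adj_not_mem hρ (hGadj ha₀).symm ha₀Q
    have hav' : a ≠ v' :=
      ne_end_of_two_mem w₁ ha₀ w₂ (hγeq ▸ hγ) hw₁ hxQ hx'Q hxx' (hγeq ▸ hxγ) (hγeq ▸ hx'γ)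
    have haγ : a ∈ γ.support := by
      rw [hγeq, SimpleGraph.Walk.mem_support_append_iff]
      refine Or.inr ?_
      rw [SimpleGraph.Walk.support_cons]
      exact List.mem_cons_of_mem _ w₂.start_mem_support
    have haN : a - o ∈ box 3 r := hnf a haγ hav'
    have ha₀C : (openGraph (av (insert (Sum.inl s(x, x')) ξ \ Sum.inl '' {f | ∃ y ∈ f, y ∈ Q}))).Reachable
        o a₀ := reachable_closed_of_walk_avoiding hav w₁ hw₁
    obtain ⟨-, -, -, -, hat, -, -, C2, C3, -, C5⟩ :=
      linking_conditions_of_protrusion (a := a) hρ hρr hprot haQ haN had hdN (Or.inr ⟨a₀, hGadj ha₀, ha₀Q⟩)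
    obtain ⟨Xa, Xb, haXa, -, -, hdXb, hXab, hXaQ, hXbQ, hXaN, hlinka, hlinkb⟩ :=
      exists_linking_sets (o := o) (r := r) hs hρ haQ htQ had htd haN hdN hP C1 C2 C3 C4 C5
    refine exists_pivotal_config hav hA hm hxQ hdD hdQ hQD' hQx hXab hdXb hXaQ hXbQ hXaN
      (fun h => absurd h hoQ) (Conn := {s(a₀, a)}) ?_ ?_ ?_
      (Or.inr (Or.inr ⟨a₀, ⟨w₁, hw₁⟩, rfl⟩)) hlinka hlinkb (Or.inl htfar)
    · intro f hf; rw [Set.mem_singleton_iff] at hf; subst hf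
      exact ⟨a, Sym2.mem_mk_right _ _, haQ⟩
    · intro f hf; rw [Set.mem_singleton_iff] at hf; subst hf; exact havadj ha₀
    · intro f hf; rw [Set.mem_singleton_iff] at hf; subst hf
      left
      intro y hy
      rcases Sym2.mem_iff.1 hy with rfl | rfl
      · exact Or.inl ha₀C
      · exact Or.inr haXa


/-- **The local modification lemma** (Aizenman–Grimmett / Martineau–Severo Lemma 6.1 for the
restoration enhancement, uniformly in the deleted set). Let `D` have one point `dsel j` within `R` of
each centre `o + (2h+1) j`, `h > 3R`, and let `r = L(2h+1) + h`, `L ≥ 1`. If an edge `e` of `ℤ³` is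
pivotal for the exit event `A` at `ξ`, there are a configuration `ξ'`, differing from `ξ` only on edges
within `2(h+R+1)` of an endpoint of `e` and not at all on marks, and a vertex `z` within `h+R` of an
endpoint of `e` whose mark is pivotal for `A` at `ξ'`. -/
theorem exists_local_modification
    (hav : ∀ ξ f, f ∈ av ξ ↔ Sum.inl f ∈ ξ ∧ f ∈ (zdGraph 3).edgeSet ∧ ∀ y ∈ f, y ∈ D → Sum.inr y ∈ ξ)
    (hA : ∀ ξ, ξ ∈ A ↔ ∃ v, (openGraph (av ξ)).Reachable o v ∧ v - o ∉ box 3 r)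
    {dsel : Site 3 → Site 3} {R h L : ℕ} (hD : ∀ y, y ∈ D ↔ ∃ j, dsel j = y)
    (hnear : ∀ j i, -(R : ℤ) ≤ dsel j i - o i - (2 * h + 1) * j i ∧ dsel j i - o i - (2 * h + 1) * j i ≤ R)
    (hh : 3 * R < h) (hr : r = L * (2 * h + 1) + h) (hL : 1 ≤ L)
    {ξ : Set (Sym2 (Site 3) ⊕ Site 3)} {e : Sym2 (Site 3)} (he : e ∈ (zdGraph 3).edgeSet)
    (hpiv : IsPivotal A (Sum.inl e) ξ) :
    ∃ (ξ' : Set (Sym2 (Site 3) ⊕ Site 3)) (z : Site 3),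
      (∀ f, (∀ x ∈ e, ∀ y ∈ f, y - x ∉ box 3 (2 * (h + R + 1))) → (Sum.inl f ∈ ξ' ↔ Sum.inl f ∈ ξ)) ∧
      (∀ y, Sum.inr y ∈ ξ' ↔ Sum.inr y ∈ ξ) ∧
      (∃ x ∈ e, z - x ∈ box 3 (h + R)) ∧ IsPivotal A (Sum.inr z) ξ' := by
  classical
  induction e using Sym2.inductionOn with
  | hf x₁ x₂ =>
  have hup : IsUpperSet A := isUpperSet_event hav hA
  rw [ProdWeight.isPivotal_iff_of_upper hup] at hpiv
  obtain ⟨hplus, hminus⟩ := hpiv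
  by_cases hyD : ∃ y ∈ s(x₁, x₂), y ∈ D
  · -- an endpoint of `e` is a (necessarily restored) deleted vertex: its mark is pivotal at `ξ ∪ {e}`
    obtain ⟨y, hy, hyD⟩ := hyD
    refine ⟨insert (Sum.inl s(x₁, x₂)) ξ, y, fun f hf => ?_, fun y' => ?_,
      ⟨y, hy, by rw [sub_self]; exact zero_mem_box 3 _⟩, ?_⟩
    · rw [Set.mem_insert_iff]
      constructor
      · rintro (h | h)
        · rw [Sum.inl_injective h] at hf
          exact absurd (by rw [sub_self]; exact zero_mem_box 3 _) (hf y hy y hy)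
        · exact h
      · exact Or.inr
    · rw [Set.mem_insert_iff]
      exact ⟨fun h => h.resolve_left Sum.inr_ne_inl, Or.inr⟩
    · rw [ProdWeight.isPivotal_iff_of_upper hup]
      refine ⟨hup (Set.subset_insert _ _) hplus, fun hmem => hminus ?_⟩
      rw [hA] at hmem ⊢
      obtain ⟨v, hv, hfar⟩ := hmem
      refine ⟨v, reachable_openGraph_mono (fun f hf => ?_) hv, hfar⟩
      have hf' : f ∈ av (insert (Sum.inl s(x₁, x₂)) ξ) := av_mono hav Set.sdiff_subset hf
      refine av_diff_of_ne hav hf' ?_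
      rintro rfl
      rw [hav] at hf
      exact (hf.2.2 y hy hyD).2 rfl
  · -- main case: no endpoint of `e` is deleted
    push Not at hyD
    -- a far-reaching available path of `ξ ∪ {e}`, stopped at its first far vertex, made simple
    obtain ⟨v, ⟨w₀⟩, hvfar⟩ := (hA _).1 hplus
    have ho : ¬ (o - o ∉ box 3 r) := fun h' => h' (by rw [sub_self]; exact zero_mem_box 3 r)
    obtain ⟨u₀, v', w₁, hadj, -, -, hw₁, hv'far⟩ :=
      exists_first_entrance {z : Site 3 | z - o ∉ box 3 r} w₀ ho hvfar
    set γ₀ : (openGraph (av (insert (Sum.inl s(x₁, x₂)) ξ))).Walk o v' :=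
      w₁.append (SimpleGraph.Walk.cons hadj SimpleGraph.Walk.nil) with hγ₀
    have hnf₀ : ∀ z ∈ γ₀.support, z ≠ v' → z - o ∈ box 3 r := by
      intro z hz hzv
      rw [hγ₀, SimpleGraph.Walk.mem_support_append_iff, SimpleGraph.Walk.support_cons,
        SimpleGraph.Walk.support_nil, List.mem_cons, List.mem_singleton] at hz
      rcases hz with hz | rfl | rfl
      · exact not_not.1 (hw₁ z hz)
      · exact not_not.1 (hw₁ _ w₁.end_mem_support)
      · exact absurd rfl hzv
    set γ := γ₀.bypass with hγ
    have hγpath : γ.IsPath := γ₀.bypass_isPath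
    have hnf : ∀ z ∈ γ.support, z ≠ v' → z - o ∈ box 3 r := fun z hz hzv =>
      hnf₀ z (γ₀.support_bypass_subset_support hz) hzv
    -- the path uses `e`
    have heγ : s(x₁, x₂) ∈ γ.edges := by
      by_contra hne
      refine hminus ((hA _).2 ⟨v', reachable_openGraph_of_edges γ fun f hf => ?_, hv'far⟩)
      refine av_diff_of_ne hav (mem_of_mem_edges_openGraph γ hf) ?_
      rintro rfl
      exact hne hf
    -- radii
    have hρr : h + R + 1 ≤ r := by rw [hr]; nlinarith
    -- endpoints of `e`; the one different from `v'` is not far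
    have hadj₁₂ : (zdGraph 3).Adj x₁ x₂ := (SimpleGraph.mem_edgeSet _).1 he
    have hx₁₂ : x₁ ≠ x₂ := hadj₁₂.ne
    -- symmetric form of the remaining argument
    have main : ∀ x x' : Site 3, s(x₁, x₂) = s(x, x') → x ≠ x' → x ≠ v' → (zdGraph 3).Adj x x' →
        ∃ (ξ' : Set (Sym2 (Site 3) ⊕ Site 3)) (z : Site 3),
          (∀ f, (∀ x ∈ s(x₁, x₂), ∀ y ∈ f, y - x ∉ box 3 (2 * (h + R + 1))) →
            (Sum.inl f ∈ ξ' ↔ Sum.inl f ∈ ξ)) ∧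
          (∀ y, Sum.inr y ∈ ξ' ↔ Sum.inr y ∈ ξ) ∧
          (∃ x ∈ s(x₁, x₂), z - x ∈ box 3 (h + R)) ∧ IsPivotal A (Sum.inr z) ξ' := by
      intro x x' hex hxx' hxv hadj'
      have heγ' : s(x, x') ∈ γ.edges := by rw [← hex]; exact heγ
      have hxγ : x ∈ γ.support := γ.fst_mem_support_of_mem_edges heγ'
      have hxN : x - o ∈ box 3 r := hnf x hxγ hxv
      obtain ⟨d, hdD, hdN, hxd, hsep⟩ := exists_tile_point hD hnear hh hr hxN
      have hxQ : x - d ∈ box 3 (h + R + 1) := box_mono 3 (Nat.le_succ _) hxd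
      have hx'Q : x' - d ∈ box 3 (h + R + 1) := sub_mem_box_succ_of_adj hxd hadj'
      have hxe : x ∈ s(x₁, x₂) := by rw [hex]; exact Sym2.mem_mk_left x x'
      have finish : ∀ ξ' : Set (Sym2 (Site 3) ⊕ Site 3),
          ((∀ f, (∀ y ∈ f, y - x ∉ box 3 (2 * (h + R + 1))) → (Sum.inl f ∈ ξ' ↔ Sum.inl f ∈ ξ)) ∧
            (∀ y, Sum.inr y ∈ ξ' ↔ Sum.inr y ∈ ξ) ∧ IsPivotal A (Sum.inr d) ξ') →
          ∃ (ξ' : Set (Sym2 (Site 3) ⊕ Site 3)) (z : Site 3),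
            (∀ f, (∀ x ∈ s(x₁, x₂), ∀ y ∈ f, y - x ∉ box 3 (2 * (h + R + 1))) →
              (Sum.inl f ∈ ξ' ↔ Sum.inl f ∈ ξ)) ∧
            (∀ y, Sum.inr y ∈ ξ' ↔ Sum.inr y ∈ ξ) ∧
            (∃ x ∈ s(x₁, x₂), z - x ∈ box 3 (h + R)) ∧ IsPivotal A (Sum.inr z) ξ' := by
        rintro ξ' ⟨hagree, hmarks, hpiv'⟩
        exact ⟨ξ', d, fun f hf => hagree f fun y hy => hf x hxe y hy, hmarks, ⟨x, hxe, sub_mem_box_comm hxd⟩, hpiv'⟩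
      by_cases hQN : ∀ v : Site 3, v - d ∈ box 3 (h + R + 1) → v - o ∈ box 3 r
      · obtain ⟨ξ', hξ'⟩ := exists_pivotal_of_subset hav hA hex hminus hxx' γ hγpath heγ hv'far
          (Nat.succ_pos _) hdD hdN hxQ hx'Q hsep hQN
        exact finish ξ' hξ'
      · obtain ⟨ξ', hξ'⟩ := exists_pivotal_of_not_subset hav hA hex hminus hxx' γ hγpath heγ hnf
          (Nat.succ_pos _) hρr hdD hdN hxQ hx'Q hsep hQN
        exact finish ξ' hξ'
    by_cases hx₁v : x₁ = v'
    · refine main x₂ x₁ Sym2.eq_swap hx₁₂.symm ?_ hadj₁₂.symm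
      rintro rfl
      exact hx₁₂ hx₁v
    · exact main x₁ x₂ rfl hx₁₂ hx₁v hadj₁₂


end Cases

end UnifDim

end Summit.CriticalPhenomena.PercolationContinuityZ3.Theorems
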